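import Literature.AlgebraicGeometry.Frobenioids.PerfectionProd
import Literature.AlgebraicGeometry.Frobenioids.BiratUnitsSplit
import Literature.AlgebraicGeometry.Frobenioids.BiratUnitsPerfectSections
import HarnessLib

/-!
# [FrdII] Thm. 3.6 (i), `Λ = ℚ`: assembling `(Φ^gp × Φ^∡)^pf(d) ≃ O^×(X^birat)` from a section and a
# unit identification (generic algebra)

Mochizuki, *The geometry of Frobenioids II: poly-Frobenioids*, Kyushu J. Math. **62** (2008) 401–460,
§3 Theorem 3.6 (i), kurims text p. 36 ll. 29–35 [cite: MochizukiFrdII2008, Thm 3.6 (i) p.36]: "`Φ^fld :=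
Φ^gp × Φ^∡`", "`(Φ^fld)^ℚ := (Φ^fld)^pf`", "The Frobenioid `(C^Λ)^istr` is of isotropic, base-trivial, and
model type, with rational function monoid naturally isomorphic to `(Φ^fld)^Λ`"; [FrdI] Prop. 4.4 (ii)–(iii)
p. 83 (the unit sequence of `A^birat`) [cite: MochizukiFrdI2008, Prop. 4.4 (iii) p.83].

GENERIC ASSEMBLY (abc-iut cell, layer L1, row M13-c3 FILE B-generic piece (7) for abc-iut-L1-t6's FILE
B-arch (S1)/(S2); seat abc-iut-w5-d194).  Data: commutative monoids `M` (the divisor monoid `Φ(d)`) and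
`N` (the unit monoid `Φ^∡(d)`), groups `U` (`= O^×(X)`) and `B` (`= O^×(X^birat)`), an injection
`i : U → B` and `δ : B → (M^pf)^gp` with `range i = ker δ` (the unit sequence of `X` in `C^pf`, whose
divisor monoid at `X` is `Φ(d)^pf`), a multiplicative SECTION `σ : (M^pf)^gp → B` of `δ` commuting with
`i(U)` (FILE A + `gpPerfSection`), and an identification `e : N^pf ≃ U` (the units of `C^pf`).  Then
* `fldPerfEquiv … : Perfection (M^gp × N) ≃* B` — the composite
  `(M^gp × N)^pf ≃ (M^gp)^pf × N^pf ≃ (M^pf)^gp × U ≃ U × (M^pf)^gp ≃ B`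
  (`Perfection.prodMulEquiv`, `gpPerfMulEquiv`, `e`, `MulEquiv.prodComm`, `splitProdMulEquiv⁻¹`);
* `fldPerfEquiv_mk` / `fldPerfEquiv_apply` — its value `i (e [u^{1/n}]) · σ (gpPerfComparison [z^{1/n}])`;
* `apply_fldPerfEquiv` — **compatibility with the divisor maps** (S2):
  `δ (fldPerfEquiv b) = gpPerfComparison M ((fst)^pf b)`, i.e. `= (divPerfection Div_fld)(b)` for the
  product datum `Div_fld = fst : Φ^gp × Φ^∡ → Φ^gp` (`divPerfection_app_apply`);
* values on the generators `[(z, 1)]`, `[(1, u)]` for the naturality reduction (S3) via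
  `BiratUnitsIntertwinesRoots.intertwines_perfection_of_forall_of`.
Classical algebra; no statement of the paper is strengthened; nothing here bears on [IUTchIII].
-/

noncomputable section

namespace Literature.AlgebraicGeometry.Frobenioids

open Function

section Assembly

universe w x y

variable {M N : Type w} [CommMonoid M] [CommMonoid N] {U : Type x} {B : Type y} [Group U] [Group B]
  (i : U →* B) (δ : B →* Algebra.GrothendieckGroup (Perfection M))
  (σ : Algebra.GrothendieckGroup (Perfection M) →* B) (e : Perfection N ≃* U)
  (hi : Injective i) (hrange : i.range = δ.ker) (hσ : ∀ x, δ (σ x) = x)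
  (hcomm : ∀ (u : U) (x : Algebra.GrothendieckGroup (Perfection M)), i u * σ x = σ x * i u)

/-- `prodCongr` on elements (definitional). (folklore) [cite: MochizukiFrdI2008, §0 p.11] -/
theorem mulEquiv_prodCongr_apply {P Q P' Q' : Type*} [MulOneClass P] [MulOneClass Q] [MulOneClass P']
    [MulOneClass Q'] (f : P ≃* P') (g : Q ≃* Q') (x : P × Q) : f.prodCongr g x = (f x.1, g x.2) := rfl

/-- **The assembled identification `(M^gp × N)^pf ≃ B`** of [FrdII] Thm. 3.6 (i) at `Λ = ℚ`:
`(M^gp × N)^pf ≃ (M^gp)^pf × N^pf ≃ (M^pf)^gp × U ≃ U × (M^pf)^gp ≃ B`.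
[cite: MochizukiFrdII2008, Thm 3.6 (i) p.36] -/
def fldPerfEquiv : Perfection (Algebra.GrothendieckGroup M × N) ≃* B :=
  (Perfection.prodMulEquiv.trans ((gpPerfMulEquiv M).prodCongr e)).trans
    (MulEquiv.prodComm.trans (splitProdMulEquiv i δ σ hi hrange hσ hcomm).symm)

/-- `fldPerfEquiv` on classes: `[(z, u)^{1/n}] ↦ i (e [u^{1/n}]) · σ (gpPerfComparison [z^{1/n}])`.
[cite: MochizukiFrdII2008, Thm 3.6 (i) p.36] -/
theorem fldPerfEquiv_mk (z : Algebra.GrothendieckGroup M) (u : N) (n : ℕ+) :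
    fldPerfEquiv i δ σ e hi hrange hσ hcomm (Perfection.mk (z, u) n) =
      i (e (Perfection.mk u n)) * σ (gpPerfComparison M (Perfection.mk z n)) := by
  show (splitProdMulEquiv i δ σ hi hrange hσ hcomm).symm
      (MulEquiv.prodComm (((gpPerfMulEquiv M).prodCongr e)
        (Perfection.prodMulEquiv (Perfection.mk (z, u) n)))) = _
  rw [splitProdMulEquiv_symm_apply]
  rfl

/-- `fldPerfEquiv` on a general element, through the two perfected projections.
[cite: MochizukiFrdII2008, Thm 3.6 (i) p.36] -/
theorem fldPerfEquiv_apply (b : Perfection (Algebra.GrothendieckGroup M × N)) :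
    fldPerfEquiv i δ σ e hi hrange hσ hcomm b =
      i (e (Perfection.map (MonoidHom.snd _ _) b)) *
        σ (gpPerfComparison M (Perfection.map (MonoidHom.fst _ _) b)) := by
  obtain ⟨⟨⟨z, u⟩, n⟩, rfl⟩ := Perfection.mk_surjective b
  exact fldPerfEquiv_mk i δ σ e hi hrange hσ hcomm z u n

/-- **Compatibility with the divisor maps (S2)**: `δ ∘ fldPerfEquiv = gpPerfComparison ∘ (fst)^pf`, the
perfected divisor map of the product datum `fst : M^gp × N → M^gp`.
[cite: MochizukiFrdII2008, Thm 3.6 (i) p.36] -/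
theorem apply_fldPerfEquiv (b : Perfection (Algebra.GrothendieckGroup M × N)) :
    δ (fldPerfEquiv i δ σ e hi hrange hσ hcomm b) =
      gpPerfComparison M (Perfection.map (MonoidHom.fst _ _) b) := by
  rw [fldPerfEquiv_apply, map_mul, apply_inl_eq_one hrange, one_mul, hσ]

/-- On the generator `[(1, u)]`: a unit. [cite: MochizukiFrdII2008, Thm 3.6 (i) p.36] -/
theorem fldPerfEquiv_of_one_left (u : N) :
    fldPerfEquiv i δ σ e hi hrange hσ hcomm (Perfection.of _ ((1 : Algebra.GrothendieckGroup M), u)) =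
      i (e (Perfection.of N u)) := by
  rw [Perfection.of_apply, fldPerfEquiv_mk, ← Perfection.of_apply, ← Perfection.of_apply,
    gpPerfComparison_of, map_one, map_one, mul_one]

/-- On the generator `[(z, 1)]`: the section at `(ι^gp)(z)`. [cite: MochizukiFrdII2008, Thm 3.6 (i) p.36] -/
theorem fldPerfEquiv_of_one_right (z : Algebra.GrothendieckGroup M) :
    fldPerfEquiv i δ σ e hi hrange hσ hcomm (Perfection.of _ (z, (1 : N))) =
      σ (gpMap (Perfection.of M) z) := by
  have h1 : e (Perfection.mk 1 1) = 1 := by rw [Perfection.mk_one]; exact e.map_one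
  rw [Perfection.of_apply, fldPerfEquiv_mk, h1, map_one, one_mul, ← Perfection.of_apply,
    gpPerfComparison_of]

/-- On `[(ι a, 1)]`, `a ∈ M`: the section at `[ι a]`. [cite: MochizukiFrdII2008, Thm 3.6 (i) p.36] -/
theorem fldPerfEquiv_of_of_one (a : M) :
    fldPerfEquiv i δ σ e hi hrange hσ hcomm
        (Perfection.of _ (Algebra.GrothendieckGroup.of a, (1 : N))) =
      σ (Algebra.GrothendieckGroup.of (Perfection.of M a)) := by
  rw [fldPerfEquiv_of_one_right, gpMap_of]

/-- The inverse on a unit `i (e p)`: the class `(1, p)` read in `(M^gp)^pf × N^pf`.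
[cite: MochizukiFrdII2008, Thm 3.6 (i) p.36] -/
theorem fldPerfEquiv_symm_inl (p : Perfection N) :
    (fldPerfEquiv i δ σ e hi hrange hσ hcomm).symm (i (e p)) =
      Perfection.prodMulEquiv.symm (1, p) := by
  apply (fldPerfEquiv i δ σ e hi hrange hσ hcomm).injective
  rw [MulEquiv.apply_symm_apply]
  obtain ⟨⟨u, n⟩, rfl⟩ := Perfection.mk_surjective p
  dsimp only
  rw [Perfection.one_def, Perfection.prodMulEquiv_symm_mk, one_pow, PNat.one_coe, pow_one, one_mul,
    fldPerfEquiv_mk, Perfection.mk_one, (gpPerfComparison M).map_one, map_one, mul_one]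

/-- The inverse on a section value `σ x`: the class `(gpPerfMulEquiv⁻¹ x, 1)` read in `(M^gp)^pf × N^pf`.
[cite: MochizukiFrdII2008, Thm 3.6 (i) p.36] -/
theorem fldPerfEquiv_symm_section (x : Algebra.GrothendieckGroup (Perfection M)) :
    (fldPerfEquiv i δ σ e hi hrange hσ hcomm).symm (σ x) =
      Perfection.prodMulEquiv.symm ((gpPerfMulEquiv M).symm x, 1) := by
  apply (fldPerfEquiv i δ σ e hi hrange hσ hcomm).injective
  rw [MulEquiv.apply_symm_apply]
  obtain ⟨⟨z, n⟩, hz⟩ := Perfection.mk_surjective ((gpPerfMulEquiv M).symm x)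
  dsimp only at hz
  have h1 : e (Perfection.mk 1 n) = 1 := by rw [Perfection.mk_one]; exact e.map_one
  rw [← hz, Perfection.one_def, Perfection.prodMulEquiv_symm_mk, one_pow, PNat.one_coe, pow_one, mul_one,
    fldPerfEquiv_mk, h1, map_one, one_mul, ← gpPerfMulEquiv_apply, hz, MulEquiv.apply_symm_apply]

end Assembly

/-! ### The perfected divisor map of P0 on elements -/

section DivPerfection

open CategoryTheory

universe w v u

variable {D : Type u} [Category.{v} D]

/-- Components of `divPerfection δ` on an arbitrary element: `gpPerfComparison ∘ (δ_A)^pf`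
(definitional unfolding of `perfectionNatTrans δ ≫ gpPerfComparisonNat Φ`).
[cite: MochizukiFrdII2008, Thm 3.6 (i) p.36] -/
theorem divPerfection_app_apply {Φ B : Dᵒᵖ ⥤ CommMonCat.{w}} (δ : B ⟶ groupificationFunctor Φ)
    (A : Dᵒᵖ) (x : Perfection (B.obj A)) :
    ((divPerfection δ).app A).hom x = gpPerfComparison (Φ.obj A) (Perfection.map (δ.app A).hom x) := rfl

end DivPerfection

end Literature.AlgebraicGeometry.Frobenioids

end
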